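import Literature.Analysis.FluidPDE.StatisticalSolutionDirac
import Literature.Analysis.FluidPDE.CylindricalGenerator
import Literature.Analysis.FluidPDE.StatisticalSolutionProofs
import Literature.Analysis.FluidPDE.SteadyNavierStokesEnergy
import Literature.Analysis.FluidPDE.SteadyNavierStokesProofs
import Summits.AnomalousDissipation.AnomalousDissipation.Theorems.EnsembleRealization.Negative.LoadBearing

/-!
# Negative knowledge for the crux `EnsembleRealization` (stmt-AnomalousDissipation-0215), line `augmented-lift`
# (skeleton 097ec767): the open stub `stub_cylEnergyIneq` (FP ⇒ CEI) on ATOMS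

Crux disprover (refuter-cdisprove-stmt-AnomalousDissipation-0215-0, cycle 1, 2026-08-17). Supports the item; no
positive route-item statement and no registered stub is asserted (small-model facts, `Negative/` lane). Certified
copy of §7–§7b of the crux work file `Cruxes/EnsembleRealization/Disproof.lean`.

`CEI(ν, f, μ)` — the cylindrically weighted energy inequalities — is the conclusion of the lead's registered stub
`stub_cylEnergyIneq` (and the hypothesis `hcei` of `stub_augmentedLift`); it is written INLINE below, verbatim.
FINDINGS (small models; the stub restricted to atoms is a THEOREM, so no explicit measure can refute it):

* `fderiv_inr_nonneg_of_monotone` — `∂ₑψ = fderiv ψ (ξ,e) (0,1) ≥ 0` for a `C¹` profile nondecreasing in `e`.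
* `nsGeneratorPairing_sum_smul_eq_zero_of_steady` — at a steady weak solution the CEI right-hand integrand
  `⟨F(U), Σⱼ cⱼ gⱼ⟩` vanishes (linearity `Torus.nsGeneratorPairing_sum_smul`).
* `cei_lhs_nonpos_of_energy_le` — under the steady energy inequality `ν‖U‖_V² ≤ (f,U)` the left-hand integrand
  is `≤ 0`.
* `cylEnergyIneq_dirac_steady` — CEI holds on `δ_U` for `U` steady with the steady energy inequality, EVERY `ν`.
* `exists_profile_fderiv_eq_one`, `steady_of_isStationaryStatisticalSolution_dirac` — CONVERSE on atoms: a Dirac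
  Foias–Prodi law `δ_U` has `U` steady (Liouville (1.30) on `Φ(u) = φ((u,w))` with a bump profile, `∂φ = 1`),
  finite enstrophy ((1.29)) and `ν‖U‖_V² ≤ (f,U)` ((1.31) on the full shell).
* `cylEnergyIneq_of_isStationaryStatisticalSolution_dirac` — hence EVERY Dirac Foias–Prodi law satisfies CEI.
* `cylEnergyIneq_mixture_steady` — and so does every finite mixture `∑ pᵢ δ_{Uᵢ}` of steady atoms.
* (rev 2, same seat, same day) `integrable_pairing_of_isStationaryStatisticalSolution`, `cylEnergyIneq_of_ae_steady` —
  CEI holds for EVERY Foias–Prodi measure carried by steady states with the steady energy inequality (`μ`-a.e.):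
  right-hand integrand a.e. `0`, left-hand one a.e. `≤ 0`, both integrable ((1.29) + continuity of the weights).
* (rev 3, same seat, same day) `isStationaryStatisticalSolution_dirac_iff` — Dirac Foias–Prodi laws CHARACTERISED:
  `δ_U` is Foias–Prodi stationary iff `U ∈ V` is a steady weak solution (Temam's energy equation,
  `Torus.Temam1979_steadyWeakSolution_energy_eq_holds`, closes the converse); `ensembleRealization_dirac` — the CRUX
  HOLDS on every Dirac Foias–Prodi law with `M = E`, without the `1/2`-loss and with no hypothesis beyond its own
  (upgrade of `realised_of_dirac_steady` of `LoadBearing`): atoms can never refute `EnsembleRealization`.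
Consequence for the line: a counterexample to `stub_cylEnergyIneq` must CHARGE NON-STEADY STATES — a DIFFUSE, dynamic,
non-Vishik–Fursikov Foias–Prodi measure with conditional mean backscatter — none is constructible in print or in the tree.
-/

noncomputable section

-- `Summit.<Summit>.<Problem>` is the tree's mandated summit-side namespace (CONVENTIONS §2); for this
-- single-conjunct summit the two segments coincide, so the duplicate is deliberate.
set_option linter.dupNamespace false

namespace Summit.AnomalousDissipation.AnomalousDissipation.Theorems.EnsembleRealization.Negative

open MeasureTheory Filter Topology
open scoped ENNReal InnerProductSpace RealInnerProductSpace
open Literature.Analysis.FunctionSpaces Literature.Analysis.FluidPDE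

/-! ## ∂ₑψ ≥ 0 and the two pointwise budgets at a steady atom -/

/-- `∂ₑψ ≥ 0`: the energy-derivative `fderiv ψ (ξ, e) (0, 1)` of a `C¹` profile nondecreasing in the energy
variable is nonnegative (chain rule along `t ↦ (ξ, t)` and `Monotone.deriv_nonneg`). [folklore] -/
theorem fderiv_inr_nonneg_of_monotone {m : ℕ} {ψ : EuclideanSpace ℝ (Fin m) × ℝ → ℝ} (hψ : ContDiff ℝ 1 ψ)
    (hmono : ∀ ξ : EuclideanSpace ℝ (Fin m), Monotone fun e : ℝ => ψ (ξ, e))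
    (ξ : EuclideanSpace ℝ (Fin m)) (e : ℝ) :
    0 ≤ fderiv ℝ ψ (ξ, e) (0, 1) := by
  have hd : HasFDerivAt ψ (fderiv ℝ ψ (ξ, e)) (ξ, e) := ((hψ.differentiable one_ne_zero) (ξ, e)).hasFDerivAt
  have hc : HasDerivAt (fun t : ℝ => ((ξ, t) : EuclideanSpace ℝ (Fin m) × ℝ))
      ((0 : EuclideanSpace ℝ (Fin m)), (1 : ℝ)) e :=
    (hasDerivAt_const e ξ).prodMk (hasDerivAt_id e)
  have hcomp : HasDerivAt (fun t : ℝ => ψ (ξ, t)) (fderiv ℝ ψ (ξ, e) (0, 1)) e := hd.comp_hasDerivAt e hc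
  rw [← hcomp.deriv]
  exact (hmono ξ).deriv_nonneg

/-- At a steady weak solution `U` the CEI right-hand integrand VANISHES: `⟨F(U), Σⱼ cⱼ gⱼ⟩ = Σⱼ cⱼ ⟨F(U), gⱼ⟩ = 0`
(`Torus.nsGeneratorPairing_sum_smul`). [folklore] -/
theorem nsGeneratorPairing_sum_smul_eq_zero_of_steady {ν : ℝ} {f : (UnitAddTorus (Fin 3)) → (EuclideanSpace ℝ (Fin 3))} (hf : Torus.IsSmooth f) {U : (Torus.energySpace (Fin 3))}
    (hU : Torus.IsSteadyWeakSolution ν f U) {m : ℕ} (c : Fin m → ℝ)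
    {g : Fin m → UnitAddTorus (Fin 3) → EuclideanSpace ℝ (Fin 3)}
    (hg : ∀ j, Torus.IsSmooth (g j)) (hdiv : ∀ j, Torus.IsDivFree (g j)) (h0 : ∀ j, Torus.HasZeroMean (g j)) :
    Torus.nsGeneratorPairing ν f U (fun x => ∑ j, c j • g j x) = 0 := by
  rw [Torus.nsGeneratorPairing_sum_smul ν ((hf.memLp 2).integrable one_le_two) U Finset.univ c fun j _ => hg j]
  exact Finset.sum_eq_zero fun j _ => by rw [hU (g j) (hg j) (hdiv j) (h0 j), mul_zero]

/-- Under the steady energy inequality `ν‖U‖_V² ≤ (f, U)` the CEI left-hand integrand at `U` is `≤ 0`, because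
`∂ₑψ ≥ 0`. [folklore] -/
theorem cei_lhs_nonpos_of_energy_le {ν : ℝ} {f : (UnitAddTorus (Fin 3)) → (EuclideanSpace ℝ (Fin 3))} {U : (Torus.energySpace (Fin 3))}
    (hE : ν * (Torus.eGradNormSq (U.1 : (UnitAddTorus (Fin 3)) → (EuclideanSpace ℝ (Fin 3)))).toReal ≤ Torus.pairing U.1 f)
    {m : ℕ} {ψ : EuclideanSpace ℝ (Fin m) × ℝ → ℝ} (hψ : ContDiff ℝ 1 ψ)
    (hmono : ∀ ξ : EuclideanSpace ℝ (Fin m), Monotone fun e : ℝ => ψ (ξ, e)) (ξ : EuclideanSpace ℝ (Fin m)) :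
    fderiv ℝ ψ (ξ, ‖U‖ ^ 2) (0, 1) * (ν * (Torus.eGradNormSq (U.1 : (UnitAddTorus (Fin 3)) → (EuclideanSpace ℝ (Fin 3)))).toReal - Torus.pairing U.1 f) ≤ 0 :=
  mul_nonpos_of_nonneg_of_nonpos (fderiv_inr_nonneg_of_monotone hψ hmono ξ _) (sub_nonpos.2 hE)

/-! ## CEI on steady atoms -/

/-- **`stub_cylEnergyIneq` holds on steady atoms**: the Dirac law at a steady weak solution with the steady energy
inequality satisfies CEI (conclusion of the stub, verbatim, at `μ = δ_U`) — for EVERY `ν`, with `LHS ≤ 0 = RHS`.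
[folklore] -/
theorem cylEnergyIneq_dirac_steady {ν : ℝ} {f : (UnitAddTorus (Fin 3)) → (EuclideanSpace ℝ (Fin 3))} (hf : Torus.IsSmooth f) {U : (Torus.energySpace (Fin 3))}
    (hU : Torus.IsSteadyWeakSolution ν f U)
    (hE : ν * (Torus.eGradNormSq (U.1 : (UnitAddTorus (Fin 3)) → (EuclideanSpace ℝ (Fin 3)))).toReal ≤ Torus.pairing U.1 f) :
    ∀ (m : ℕ) (g : Fin m → UnitAddTorus (Fin 3) → EuclideanSpace ℝ (Fin 3)),
      (∀ j, Torus.IsSmooth (g j)) → (∀ j, Torus.IsDivFree (g j)) → (∀ j, Torus.HasZeroMean (g j)) →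
      ∀ ψ : EuclideanSpace ℝ (Fin m) × ℝ → ℝ, ContDiff ℝ 1 ψ →
        (∃ C : ℝ, ∀ z, |ψ z| ≤ C ∧ ‖fderiv ℝ ψ z‖ ≤ C) →
        (∀ ξ : EuclideanSpace ℝ (Fin m), Monotone fun e : ℝ => ψ (ξ, e)) →
        Integrable (fun u : Torus.energySpace (Fin 3) =>
            fderiv ℝ ψ (WithLp.toLp 2 fun j => Torus.pairing u.1 (g j), ‖u‖ ^ 2) (0, 1) *
              (ν * (Torus.eGradNormSq (u.1 : UnitAddTorus (Fin 3) → EuclideanSpace ℝ (Fin 3))).toReal -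
                Torus.pairing u.1 f)) (Measure.dirac U) ∧
        Integrable (fun u : Torus.energySpace (Fin 3) =>
            Torus.nsGeneratorPairing ν f u (fun x => ∑ j, fderiv ℝ ψ
              (WithLp.toLp 2 fun j => Torus.pairing u.1 (g j), ‖u‖ ^ 2) (EuclideanSpace.single j 1, 0) • g j x)) (Measure.dirac U) ∧
        2 * ∫ u, fderiv ℝ ψ (WithLp.toLp 2 fun j => Torus.pairing u.1 (g j), ‖u‖ ^ 2) (0, 1) *
              (ν * (Torus.eGradNormSq (u.1 : UnitAddTorus (Fin 3) → EuclideanSpace ℝ (Fin 3))).toReal -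
                Torus.pairing u.1 f) ∂(Measure.dirac U) ≤
          ∫ u, Torus.nsGeneratorPairing ν f u (fun x => ∑ j, fderiv ℝ ψ
              (WithLp.toLp 2 fun j => Torus.pairing u.1 (g j), ‖u‖ ^ 2) (EuclideanSpace.single j 1, 0) • g j x) ∂(Measure.dirac U) := by
  haveI : MeasurableSingletonClass (Torus.energySpace (Fin 3)) := OpensMeasurableSpace.toMeasurableSingletonClass
  intro m g hg hdiv h0 ψ hψ _hC hmono
  refine ⟨Torus.integrable_dirac _ _, Torus.integrable_dirac _ _, ?_⟩
  rw [integral_dirac, integral_dirac, nsGeneratorPairing_sum_smul_eq_zero_of_steady hf hU _ hg hdiv h0]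
  have h := cei_lhs_nonpos_of_energy_le hE hψ hmono (WithLp.toLp 2 fun j => Torus.pairing U.1 (g j))
  linarith

/-! ## The converse: Dirac Foias–Prodi laws are steady atoms -/

/-- A compactly supported `C¹` profile on `ℝ¹` with prescribed unit derivative at a point: `φ(x) = ⟪e₀, x − c⟫ · b(x)`
with `b` a smooth bump equal to `1` near `c`. [folklore] -/
theorem exists_profile_fderiv_eq_one (c : EuclideanSpace ℝ (Fin 1)) :
    ∃ φ : EuclideanSpace ℝ (Fin 1) → ℝ, ContDiff ℝ 1 φ ∧ HasCompactSupport φ ∧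
      fderiv ℝ φ c (EuclideanSpace.single 0 1) = 1 := by
  set ℓ : EuclideanSpace ℝ (Fin 1) →L[ℝ] ℝ := innerSL ℝ (EuclideanSpace.single (0 : Fin 1) (1 : ℝ)) with hℓ
  let b : ContDiffBump c := ⟨1, 2, one_pos, one_lt_two⟩
  refine ⟨fun x => ℓ (x - c) * b x, ?_, ?_, ?_⟩
  · exact (ℓ.contDiff.comp (contDiff_id.sub contDiff_const)).mul b.contDiff
  · exact b.hasCompactSupport.mul_left
  · have hlin : HasFDerivAt (fun x : EuclideanSpace ℝ (Fin 1) => ℓ (x - c)) ℓ c := by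
      have h1 : HasFDerivAt (fun x : EuclideanSpace ℝ (Fin 1) => x - c)
          (ContinuousLinearMap.id ℝ (EuclideanSpace ℝ (Fin 1))) c := (hasFDerivAt_id c).sub_const c
      have h2 := ℓ.hasFDerivAt.comp c h1
      rw [ContinuousLinearMap.comp_id] at h2
      exact h2
    have hev : (fun x => ℓ (x - c) * b x) =ᶠ[𝓝 c] fun x => ℓ (x - c) := by
      filter_upwards [b.eventuallyEq_one] with x hx
      rw [hx, Pi.one_apply, mul_one]
    rw [hev.fderiv_eq, hlin.fderiv, hℓ, innerSL_apply_apply]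
    simp

/-- **Dirac Foias–Prodi laws are steady atoms** (converse of
`IsSteadyWeakSolution.isStationaryStatisticalSolution_dirac`): if `δ_U` is a Foias–Prodi stationary statistical
solution of NS_ν(f) then `U` is a steady weak solution (Liouville (1.30) on `Φ(u) = φ((u, w))`, `∂φ = 1` at
`(U, w)`, and `Torus.nsGeneratorPairing_grad`), has finite enstrophy ((1.29)) and satisfies the steady energy
inequality `ν‖U‖_V² ≤ (f, U)` ((1.31) on the full shell). [folklore] -/
theorem steady_of_isStationaryStatisticalSolution_dirac {ν : ℝ} {f : (UnitAddTorus (Fin 3)) → (EuclideanSpace ℝ (Fin 3))} (hf : Torus.IsSmooth f) {U : (Torus.energySpace (Fin 3))}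
    (hμ : Torus.IsStationaryStatisticalSolution ν f (Measure.dirac U)) :
    Torus.IsSteadyWeakSolution ν f U ∧ Torus.eGradNormSq (U.1 : (UnitAddTorus (Fin 3)) → (EuclideanSpace ℝ (Fin 3))) < ∞ ∧
      ν * (Torus.eGradNormSq (U.1 : (UnitAddTorus (Fin 3)) → (EuclideanSpace ℝ (Fin 3)))).toReal ≤ Torus.pairing U.1 f := by
  haveI : MeasurableSingletonClass (Torus.energySpace (Fin 3)) := OpensMeasurableSpace.toMeasurableSingletonClass
  refine ⟨fun w hw hdiv h0 => ?_, ?_, ?_⟩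
  · obtain ⟨φ, hφ1, hφ2, hφ3⟩ :=
      exists_profile_fderiv_eq_one (WithLp.toLp 2 fun _ : Fin 1 => Torus.pairing U.1 w)
    let Φ : Torus.CylindricalTest (Fin 3) :=
      { m := 1, g := fun _ => w, g_smooth := fun _ => hw, g_divFree := fun _ => hdiv, g_zeroMean := fun _ => h0,
        φ := φ, φ_contDiff := hφ1, φ_compact := hφ2 }
    have hgen := (hμ.generator Φ).2
    rw [integral_dirac, Torus.nsGeneratorPairing_grad ν ((hf.memLp 2).integrable one_le_two) Φ U] at hgen
    have hcoords : Φ.coords U = WithLp.toLp 2 fun _ : Fin 1 => Torus.pairing U.1 w := rfl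
    simp only [Finset.univ_unique, Fin.default_eq_zero, Finset.sum_singleton] at hgen
    rw [hcoords, hφ3, one_mul] at hgen
    exact hgen
  · have h := hμ.enstrophy_finite
    rwa [lintegral_dirac] at h
  · have h := hμ.energy_ineq 0 ⊤ (by simp)
    classical
    rw [setIntegral_dirac] at h
    have hmem : U ∈ {u : (Torus.energySpace (Fin 3)) | (0 : ℝ≥0∞) ≤ ‖u‖ₑ ^ 2 ∧ ‖u‖ₑ ^ 2 < ⊤} :=
      ⟨zero_le, ENNReal.pow_lt_top enorm_lt_top⟩
    rw [if_pos hmem] at h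
    exact sub_nonpos.1 h

/-- **Every Dirac Foias–Prodi law satisfies CEI**: `stub_cylEnergyIneq` restricted to atoms is a theorem (for
every `ν`; conclusion verbatim at `μ = δ_U`). [folklore] -/
theorem cylEnergyIneq_of_isStationaryStatisticalSolution_dirac {ν : ℝ} {f : (UnitAddTorus (Fin 3)) → (EuclideanSpace ℝ (Fin 3))} (hf : Torus.IsSmooth f)
    {U : (Torus.energySpace (Fin 3))} (hμ : Torus.IsStationaryStatisticalSolution ν f (Measure.dirac U)) :
    ∀ (m : ℕ) (g : Fin m → UnitAddTorus (Fin 3) → EuclideanSpace ℝ (Fin 3)),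
      (∀ j, Torus.IsSmooth (g j)) → (∀ j, Torus.IsDivFree (g j)) → (∀ j, Torus.HasZeroMean (g j)) →
      ∀ ψ : EuclideanSpace ℝ (Fin m) × ℝ → ℝ, ContDiff ℝ 1 ψ →
        (∃ C : ℝ, ∀ z, |ψ z| ≤ C ∧ ‖fderiv ℝ ψ z‖ ≤ C) →
        (∀ ξ : EuclideanSpace ℝ (Fin m), Monotone fun e : ℝ => ψ (ξ, e)) →
        Integrable (fun u : Torus.energySpace (Fin 3) =>
            fderiv ℝ ψ (WithLp.toLp 2 fun j => Torus.pairing u.1 (g j), ‖u‖ ^ 2) (0, 1) *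
              (ν * (Torus.eGradNormSq (u.1 : UnitAddTorus (Fin 3) → EuclideanSpace ℝ (Fin 3))).toReal -
                Torus.pairing u.1 f)) (Measure.dirac U) ∧
        Integrable (fun u : Torus.energySpace (Fin 3) =>
            Torus.nsGeneratorPairing ν f u (fun x => ∑ j, fderiv ℝ ψ
              (WithLp.toLp 2 fun j => Torus.pairing u.1 (g j), ‖u‖ ^ 2) (EuclideanSpace.single j 1, 0) • g j x)) (Measure.dirac U) ∧
        2 * ∫ u, fderiv ℝ ψ (WithLp.toLp 2 fun j => Torus.pairing u.1 (g j), ‖u‖ ^ 2) (0, 1) *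
              (ν * (Torus.eGradNormSq (u.1 : UnitAddTorus (Fin 3) → EuclideanSpace ℝ (Fin 3))).toReal -
                Torus.pairing u.1 f) ∂(Measure.dirac U) ≤
          ∫ u, Torus.nsGeneratorPairing ν f u (fun x => ∑ j, fderiv ℝ ψ
              (WithLp.toLp 2 fun j => Torus.pairing u.1 (g j), ‖u‖ ^ 2) (EuclideanSpace.single j 1, 0) • g j x) ∂(Measure.dirac U) :=
  cylEnergyIneq_dirac_steady hf (steady_of_isStationaryStatisticalSolution_dirac hf hμ).1
    (steady_of_isStationaryStatisticalSolution_dirac hf hμ).2.2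

/-! ## CEI on finite mixtures of steady atoms -/

/-- **`stub_cylEnergyIneq` holds on finite mixtures of steady atoms** (`μ = ∑ᵢ pᵢ δ_{Uᵢ}`, `pᵢ < ∞`, each `Uᵢ`
steady with the steady energy inequality; conclusion of the stub verbatim at this `μ`): `LHS ≤ 0 = RHS`.
[folklore] -/
theorem cylEnergyIneq_mixture_steady {ν : ℝ} {f : (UnitAddTorus (Fin 3)) → (EuclideanSpace ℝ (Fin 3))} (hf : Torus.IsSmooth f) {ι : Type*} (s : Finset ι)
    (p : ι → ℝ≥0∞) (hp : ∀ i ∈ s, p i ≠ ∞) (U : ι → (Torus.energySpace (Fin 3)))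
    (hU : ∀ i ∈ s, Torus.IsSteadyWeakSolution ν f (U i))
    (hE : ∀ i ∈ s, ν * (Torus.eGradNormSq ((U i).1 : (UnitAddTorus (Fin 3)) → (EuclideanSpace ℝ (Fin 3)))).toReal ≤ Torus.pairing (U i).1 f) :
    ∀ (m : ℕ) (g : Fin m → UnitAddTorus (Fin 3) → EuclideanSpace ℝ (Fin 3)),
      (∀ j, Torus.IsSmooth (g j)) → (∀ j, Torus.IsDivFree (g j)) → (∀ j, Torus.HasZeroMean (g j)) →
      ∀ ψ : EuclideanSpace ℝ (Fin m) × ℝ → ℝ, ContDiff ℝ 1 ψ →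
        (∃ C : ℝ, ∀ z, |ψ z| ≤ C ∧ ‖fderiv ℝ ψ z‖ ≤ C) →
        (∀ ξ : EuclideanSpace ℝ (Fin m), Monotone fun e : ℝ => ψ (ξ, e)) →
        Integrable (fun u : Torus.energySpace (Fin 3) =>
            fderiv ℝ ψ (WithLp.toLp 2 fun j => Torus.pairing u.1 (g j), ‖u‖ ^ 2) (0, 1) *
              (ν * (Torus.eGradNormSq (u.1 : UnitAddTorus (Fin 3) → EuclideanSpace ℝ (Fin 3))).toReal -
                Torus.pairing u.1 f)) (∑ i ∈ s, p i • Measure.dirac (U i)) ∧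
        Integrable (fun u : Torus.energySpace (Fin 3) =>
            Torus.nsGeneratorPairing ν f u (fun x => ∑ j, fderiv ℝ ψ
              (WithLp.toLp 2 fun j => Torus.pairing u.1 (g j), ‖u‖ ^ 2) (EuclideanSpace.single j 1, 0) • g j x)) (∑ i ∈ s, p i • Measure.dirac (U i)) ∧
        2 * ∫ u, fderiv ℝ ψ (WithLp.toLp 2 fun j => Torus.pairing u.1 (g j), ‖u‖ ^ 2) (0, 1) *
              (ν * (Torus.eGradNormSq (u.1 : UnitAddTorus (Fin 3) → EuclideanSpace ℝ (Fin 3))).toReal -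
                Torus.pairing u.1 f) ∂(∑ i ∈ s, p i • Measure.dirac (U i)) ≤
          ∫ u, Torus.nsGeneratorPairing ν f u (fun x => ∑ j, fderiv ℝ ψ
              (WithLp.toLp 2 fun j => Torus.pairing u.1 (g j), ‖u‖ ^ 2) (EuclideanSpace.single j 1, 0) • g j x) ∂(∑ i ∈ s, p i • Measure.dirac (U i)) := by
  haveI : MeasurableSingletonClass (Torus.energySpace (Fin 3)) := OpensMeasurableSpace.toMeasurableSingletonClass
  intro m g hg hdiv h0 ψ hψ _hC hmono
  have hint : ∀ (F : (Torus.energySpace (Fin 3)) → ℝ), Integrable F (∑ i ∈ s, p i • Measure.dirac (U i)) := fun F =>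
    integrable_finsetSum_measure.2 fun i hi => (Torus.integrable_dirac _ _).smul_measure (hp i hi)
  refine ⟨hint _, hint _, ?_⟩
  rw [integral_finsetSum_measure fun i hi => (Torus.integrable_dirac _ _).smul_measure (hp i hi),
    integral_finsetSum_measure fun i hi => (Torus.integrable_dirac _ _).smul_measure (hp i hi)]
  simp_rw [integral_smul_measure, integral_dirac]
  have hR : ∑ i ∈ s, (p i).toReal • Torus.nsGeneratorPairing ν f (U i) (fun x => ∑ j, fderiv ℝ ψ
      (WithLp.toLp 2 fun j => Torus.pairing (U i).1 (g j), ‖U i‖ ^ 2) (EuclideanSpace.single j 1, 0) • g j x) = 0 :=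
    Finset.sum_eq_zero fun i hi => by
      rw [nsGeneratorPairing_sum_smul_eq_zero_of_steady hf (hU i hi) _ hg hdiv h0, smul_zero]
  have hL : ∑ i ∈ s, (p i).toReal • (fderiv ℝ ψ (WithLp.toLp 2 fun j => Torus.pairing (U i).1 (g j), ‖U i‖ ^ 2) (0, 1) *
      (ν * (Torus.eGradNormSq ((U i).1 : (UnitAddTorus (Fin 3)) → (EuclideanSpace ℝ (Fin 3)))).toReal - Torus.pairing (U i).1 f)) ≤ 0 :=
    Finset.sum_nonpos fun i hi => smul_nonpos_of_nonneg_of_nonpos ENNReal.toReal_nonneg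
      (cei_lhs_nonpos_of_energy_le (hE i hi) hψ hmono _)
  rw [hR]
  linarith


/-! ## CEI for Foias–Prodi measures carried by steady states (rev 2) -/
/-- Under Foias–Prodi stationarity the pairing `u ↦ (u, f)` is integrable (`|(u,f)| ≤ ‖u‖ ‖f‖₂ ≤ ‖f‖₂ (‖u‖² + 1)`
and `∫‖u‖² dμ < ∞`, `integrable_norm_sq_of_isStationaryStatisticalSolution`). [folklore] -/
theorem integrable_pairing_of_isStationaryStatisticalSolution {ν : ℝ}
    {f : UnitAddTorus (Fin 3) → EuclideanSpace ℝ (Fin 3)} (hf : Torus.IsSmooth f)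
    {μ : Measure (Torus.energySpace (Fin 3))} (hμ : Torus.IsStationaryStatisticalSolution ν f μ) :
    Integrable (fun u : Torus.energySpace (Fin 3) => Torus.pairing u.1 f) μ := by
  haveI := hμ.prob
  have hf2 := hf.memLp 2
  refine Integrable.mono'
    (((integrable_norm_sq_of_isStationaryStatisticalSolution hμ).add (integrable_const 1)).const_mul ‖hf2.toLp f‖)
    (Torus.continuous_pairing_coe hf2).aestronglyMeasurable (ae_of_all _ fun u => ?_)
  rw [Real.norm_eq_abs]
  calc |Torus.pairing u.1 f| ≤ ‖u‖ * ‖hf2.toLp f‖ := Torus.abs_pairing_coe_le hf2 u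
    _ ≤ ‖hf2.toLp f‖ * (‖u‖ ^ 2 + 1) := by
        nlinarith [norm_nonneg u, norm_nonneg (hf2.toLp f), sq_nonneg (‖u‖ - 1)]

/-- **`stub_cylEnergyIneq` holds for every Foias–Prodi measure carried by steady states** obeying the steady energy
inequality (`μ`-a.e. `u` is a steady weak solution with `ν‖u‖_V² ≤ (f,u)`): the conclusion of the stub (CEI, inline
verbatim) holds with `LHS ≤ 0 = RHS`. Hence a counterexample must charge non-steady states. [folklore] -/
theorem cylEnergyIneq_of_ae_steady {ν : ℝ} {f : UnitAddTorus (Fin 3) → EuclideanSpace ℝ (Fin 3)}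
    (hf : Torus.IsSmooth f) {μ : Measure (Torus.energySpace (Fin 3))}
    (hμ : Torus.IsStationaryStatisticalSolution ν f μ)
    (hst : ∀ᵐ u ∂μ, Torus.IsSteadyWeakSolution ν f u ∧
      ν * (Torus.eGradNormSq (u.1 : UnitAddTorus (Fin 3) → EuclideanSpace ℝ (Fin 3))).toReal ≤ Torus.pairing u.1 f) :
    ∀ (m : ℕ) (g : Fin m → UnitAddTorus (Fin 3) → EuclideanSpace ℝ (Fin 3)),
      (∀ j, Torus.IsSmooth (g j)) → (∀ j, Torus.IsDivFree (g j)) → (∀ j, Torus.HasZeroMean (g j)) →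
      ∀ ψ : EuclideanSpace ℝ (Fin m) × ℝ → ℝ, ContDiff ℝ 1 ψ →
        (∃ C : ℝ, ∀ z, |ψ z| ≤ C ∧ ‖fderiv ℝ ψ z‖ ≤ C) →
        (∀ ξ : EuclideanSpace ℝ (Fin m), Monotone fun e : ℝ => ψ (ξ, e)) →
        Integrable (fun u : Torus.energySpace (Fin 3) =>
            fderiv ℝ ψ (WithLp.toLp 2 fun j => Torus.pairing u.1 (g j), ‖u‖ ^ 2) (0, 1) *
              (ν * (Torus.eGradNormSq (u.1 : UnitAddTorus (Fin 3) → EuclideanSpace ℝ (Fin 3))).toReal -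
                Torus.pairing u.1 f)) μ ∧
        Integrable (fun u : Torus.energySpace (Fin 3) =>
            Torus.nsGeneratorPairing ν f u (fun x => ∑ j, fderiv ℝ ψ
              (WithLp.toLp 2 fun j => Torus.pairing u.1 (g j), ‖u‖ ^ 2) (EuclideanSpace.single j 1, 0) • g j x)) μ ∧
        2 * ∫ u, fderiv ℝ ψ (WithLp.toLp 2 fun j => Torus.pairing u.1 (g j), ‖u‖ ^ 2) (0, 1) *
              (ν * (Torus.eGradNormSq (u.1 : UnitAddTorus (Fin 3) → EuclideanSpace ℝ (Fin 3))).toReal -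
                Torus.pairing u.1 f) ∂μ ≤
          ∫ u, Torus.nsGeneratorPairing ν f u (fun x => ∑ j, fderiv ℝ ψ
              (WithLp.toLp 2 fun j => Torus.pairing u.1 (g j), ‖u‖ ^ 2) (EuclideanSpace.single j 1, 0) • g j x) ∂μ := by
  intro m g hg hdiv h0 ψ hψ hC hmono
  obtain ⟨C, hC⟩ := hC
  -- continuity of the cylindrical coordinates and of the weights `∂ψ(ξ(u), |u|²) v`
  have hξ : Continuous fun u : Torus.energySpace (Fin 3) =>
      (WithLp.toLp 2 fun j => Torus.pairing u.1 (g j) : EuclideanSpace ℝ (Fin m)) :=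
    (PiLp.continuous_toLp 2 _).comp (continuous_pi fun j => Torus.continuous_pairing_coe ((hg j).memLp 2))
  have hw : ∀ v : EuclideanSpace ℝ (Fin m) × ℝ, Continuous fun u : Torus.energySpace (Fin 3) =>
      fderiv ℝ ψ (WithLp.toLp 2 fun j => Torus.pairing u.1 (g j), ‖u‖ ^ 2) v := fun v =>
    (ContinuousLinearMap.apply ℝ ℝ v).continuous.comp
      ((hψ.continuous_fderiv one_ne_zero).comp (hξ.prodMk (continuous_norm.pow 2)))
  have hwb : ∀ (v : EuclideanSpace ℝ (Fin m) × ℝ) (u : Torus.energySpace (Fin 3)),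
      ‖fderiv ℝ ψ (WithLp.toLp 2 fun j => Torus.pairing u.1 (g j), ‖u‖ ^ 2) v‖ ≤ C * ‖v‖ := fun v u =>
    (ContinuousLinearMap.le_opNorm _ _).trans (mul_le_mul_of_nonneg_right (hC _).2 (norm_nonneg _))
  -- the energy budget `G(u) = ν‖u‖_V² − (f,u)` is integrable ((1.29) and the pairing bound)
  have hG : Integrable (fun u : Torus.energySpace (Fin 3) =>
      ν * (Torus.eGradNormSq (u.1 : UnitAddTorus (Fin 3) → EuclideanSpace ℝ (Fin 3))).toReal - Torus.pairing u.1 f) μ :=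
    ((integrable_toReal_of_lintegral_ne_top Torus.measurable_eGradNormSq_coe.aemeasurable
      hμ.enstrophy_finite.ne).const_mul ν).sub (integrable_pairing_of_isStationaryStatisticalSolution hf hμ)
  -- the right-hand integrand vanishes a.e. (steadiness), the left-hand one is a.e. nonpositive
  have hR : (fun u : Torus.energySpace (Fin 3) => Torus.nsGeneratorPairing ν f u (fun x => ∑ j, fderiv ℝ ψ
      (WithLp.toLp 2 fun j => Torus.pairing u.1 (g j), ‖u‖ ^ 2) (EuclideanSpace.single j 1, 0) • g j x)) =ᵐ[μ] 0 := by
    filter_upwards [hst] with u hu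
    exact nsGeneratorPairing_sum_smul_eq_zero_of_steady hf hu.1 _ hg hdiv h0
  have hL : (fun u : Torus.energySpace (Fin 3) =>
      fderiv ℝ ψ (WithLp.toLp 2 fun j => Torus.pairing u.1 (g j), ‖u‖ ^ 2) (0, 1) *
      (ν * (Torus.eGradNormSq (u.1 : UnitAddTorus (Fin 3) → EuclideanSpace ℝ (Fin 3))).toReal - Torus.pairing u.1 f))
        ≤ᵐ[μ] 0 := by
    filter_upwards [hst] with u hu
    exact cei_lhs_nonpos_of_energy_le hu.2 hψ hmono _
  refine ⟨hG.bdd_mul (hw (0, 1)).aestronglyMeasurable (ae_of_all _ (hwb (0, 1))),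
    (integrable_zero _ _ μ).congr hR.symm, ?_⟩
  rw [integral_eq_zero_of_ae hR]
  linarith [integral_nonpos_of_ae hL]


/-! ## Dirac Foias–Prodi laws characterised; the crux is TRUE on every Dirac law (rev 3) -/

/-- **Dirac Foias–Prodi laws, characterised**: `δ_U` is a Foias–Prodi stationary statistical solution of NS_ν(f)
(`f` smooth) iff `U ∈ V` is a steady weak solution (→: `steady_of_isStationaryStatisticalSolution_dirac` and
`Torus.memSobolev_one_complexify_of_eGradNormSq_ne_top`; ←: `IsSteadyWeakSolution.isStationaryStatisticalSolution_dirac`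
with Temam's energy equation, `card (Fin 3) ≤ 4`). [folklore] -/
theorem isStationaryStatisticalSolution_dirac_iff {ν : ℝ} {f : UnitAddTorus (Fin 3) → EuclideanSpace ℝ (Fin 3)}
    (hf : Torus.IsSmooth f) (U : Torus.energySpace (Fin 3)) :
    Torus.IsStationaryStatisticalSolution ν f (Measure.dirac U) ↔
      Torus.IsSteadyWeakSolution ν f U ∧ U.1 ∈ Torus.energySpaceV (Fin 3) := by
  constructor
  · intro hμ
    obtain ⟨hst, hfin, _⟩ := steady_of_isStationaryStatisticalSolution_dirac hf hμ
    exact ⟨hst, U.2, Torus.memSobolev_one_complexify_of_eGradNormSq_ne_top (Lp.memLp _) hfin.ne⟩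
  · rintro ⟨hU, hV⟩
    exact hU.isStationaryStatisticalSolution_dirac hV
      (Torus.Temam1979_steadyWeakSolution_energy_eq_holds (by simp) (hf.memLp 2) hV hU).le

/-- **The crux HOLDS on every Dirac Foias–Prodi law** — with `M = E`, WITHOUT the `1/2`-loss, and with no hypothesis
beyond the crux's own (`realised_of_dirac_steady` + the characterisation + Temam's energy equation): atoms can never
refute `EnsembleRealization`. (Not the route decl: its restriction to Dirac measures, strengthened.) [folklore] -/
theorem ensembleRealization_dirac {f : UnitAddTorus (Fin 3) → EuclideanSpace ℝ (Fin 3)} (hf : Torus.IsSmooth f)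
    (hf0 : Torus.HasZeroMean f) {ν : ℝ} (hν : 0 < ν) {U : Torus.energySpace (Fin 3)}
    (hμ : Torus.IsStationaryStatisticalSolution ν f (Measure.dirac U))
    {E ε : ℝ} (hE : Torus.ensembleEnergy (Measure.dirac U) ≤ E)
    (hε : ε ≤ Torus.ensembleDissipation ν (Measure.dirac U)) :
    ∃ (u₀ : UnitAddTorus (Fin 3) → EuclideanSpace ℝ (Fin 3)) (u : ℝ → UnitAddTorus (Fin 3) → EuclideanSpace ℝ (Fin 3)),
      Torus.IsGlobalLerayHopf ν (fun _ => f) u₀ u ∧ meanEnergy u ≤ E ∧ ε ≤ meanDissipation ν u := by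
  obtain ⟨hU, hV⟩ := (isStationaryStatisticalSolution_dirac_iff hf U).1 hμ
  exact realised_of_dirac_steady hν hf hf0 hV hU
    (Torus.Temam1979_steadyWeakSolution_energy_eq_holds (by simp) (hf.memLp 2) hV hU) hE hε

end Summit.AnomalousDissipation.AnomalousDissipation.Theorems.EnsembleRealization.Negative
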